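import Mathlib
import Literature.Analysis.FluidPDE.ClassicalSolution
import Literature.Analysis.FluidPDE.LerayHopf
import Literature.Analysis.FluidPDE.NSWave0
import Summits.NavierStokesRegularity.NavierStokesRegularity.Theses.L3TimeExponentPincer
import Summits.NavierStokesRegularity.NavierStokesRegularity.Theorems.L3TimeExponentPincerNoBlowupToClay
import Summits.NavierStokesRegularity.NavierStokesRegularity.Theorems.L3TimeExponentPincerSmoothBranch
import Summits.NavierStokesRegularity.NavierStokesRegularity.Theorems.L3TimeExponentPincerSerrinEndpointRung
import Summits.NavierStokesRegularity.NavierStokesRegularity.Theorems.L3TimeExponentPincerL3BiteMorreyRate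
import Summits.NavierStokesRegularity.NavierStokesRegularity.Theorems.L3TimeExponentPincerJawExponentCalculus
import Summits.NavierStokesRegularity.NavierStokesRegularity.Theorems.HodographBetchovEquivalence
import HarnessLib

/-!
# The exponent continuum of the `L³` time-exponent pincer (crux `L3CascadeJaw`, stmt-19499):
# for EVERY `q ≥ 0`, Clay (A) `↔` (jaw at `q`) `∧` (Serrin at `q`); the known halves sit at the two ends

Support file for the PARENT crux `L3CascadeJaw` of route `L3TimeExponentPincer` (cell
ns-regularity-ideate, seat ns-pincer-19499-p1).  The route pinches at a common time-integrability exponent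
`q ∈ (4,5)` of the critical norm: the JAW at `q` ("every frame solution has `∫_{T₂}^T ‖u‖₃^q < ∞` on a
final window") and the SERRIN criterion at `q` ("a frame solution with such a window extends smoothly
past `T`").  This file records the whole one-parameter family, with the two statements written inline
(no new definitions):

* `navierStokesRegularity_of_pincerAt` — for every real `q`, jaw at `q` + Serrin at `q` ⇒ Clay (A)
  (the route's assembly with a free exponent);
* `jawAt_of_navierStokesRegularity` (`q ≥ 0`), `serrinAt_of_navierStokesRegularity` — both halves are
  ON PATH at every exponent (Clay (A) ⇒ no frame blow-up, `HodographBetchov.noBlowup_of_navierStokesRegularity`;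
  on the smooth branch `‖u(t)‖₃` is bounded, `lintegral_l3_rpow_lt_top_of_hasSmoothExtensionPast`);
* **`navierStokesRegularity_iff_pincerAt`** — for every `q ≥ 0`:
  `NavierStokesRegularity ↔ (jaw at q) ∧ (Serrin at q)`;
* monotonicity: `jawAt_anti` (the jaw gets HARDER as `q` grows), `serrinAt_mono` (Serrin gets EASIER
  as `q` grows) — the difficulty slides from the Serrin side to the jaw side along the continuum;
* the two ends: `jawAt_of_le_four'` — for `q ≤ 4` the jaw is a THEOREM (energy floor, p425265), so
  `navierStokesRegularity_iff_serrinAt_of_le_four : NavierStokesRegularity ↔ (Serrin at q)` there (at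
  `q = 4` the pincer degenerates to "no blow-up"); and at `q = ∞` Serrin is a THEOREM
  (Escauriaza–Seregin–Šverák, `supercriticalSerrinL3_rung_top`, p429062), so
  `navierStokesRegularity_iff_jawTop : NavierStokesRegularity ↔ (every frame solution is L^∞_t L³_x near
  its T)`.

Numbers: known jaw exponent `4` (left end) · known Serrin exponent `∞` (right end) · the route's window
`(4,5)` is adjacent to the KNOWN JAW end and asks the Serrin side to come down from `∞` to `< 5`; at no
exponent are both halves known.  The route's own items are the instances `L3CascadeJaw = ∀ q ∈ (4,5),
jaw at q` and `SupercriticalSerrinL3 = ∃ q ∈ (4,5), Serrin at q` (`jawAt_of_l3CascadeJaw`,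
`serrinAt_of_supercriticalSerrinL3`).

WHAT THIS IS NOT: not a claim about Navier–Stokes regularity or blow-up; logical placement of a
one-parameter family of reformulations of Clay (A), landed `--supports … --as helper`.
-/

noncomputable section

namespace Summit.NavierStokesRegularity.NavierStokesRegularity.Theorems.L3TimeExponentPincerExponentContinuum

open MeasureTheory Set Function Filter Topology
open scoped ENNReal NNReal
open Literature.Analysis.FluidPDE
open Summit.NavierStokesRegularity.NavierStokesRegularity.Theses.L3TimeExponentPincer
  (L3CascadeJaw SupercriticalSerrinL3 NoBlowupToClay)
open Summit.NavierStokesRegularity.NavierStokesRegularity.Theorems.L3TimeExponentPincerNoBlowupToClay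
  (noBlowupToClay_item)
open Summit.NavierStokesRegularity.NavierStokesRegularity.Theorems.L3TimeExponentPincerSmoothBranch
  (eLpNorm_three_bounded_of_hasSmoothExtensionPast)
open Summit.NavierStokesRegularity.NavierStokesRegularity.Theorems.L3TimeExponentPincerSerrinEndpointRung
  (supercriticalSerrinL3_rung_top lintegral_rpow_lt_top_of_memLqLp_top)
open Summit.NavierStokesRegularity.NavierStokesRegularity.Theorems.L3TimeExponentPincerL3BiteMorreyRate
  (eLpNorm_three_lt_top_of_frame)
open Summit.NavierStokesRegularity.NavierStokesRegularity.Theorems.L3TimeExponentPincerJawExponentCalculus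
  (jawClause_anti jawClause_of_le_four)

/-! ## The pincer closes at every common exponent -/

/-- **Jaw at `q` + Serrin at `q` ⇒ Clay (A), for every real `q`** (the route's assembly with a free
exponent: the jaw feeds Serrin its window hypothesis, Serrin returns no blow-up, and the landed
local-theory support `NoBlowupToClay` gives (A)). [folklore] -/
theorem navierStokesRegularity_of_pincerAt (q : ℝ)
    (hJ : ∀ (ν T : ℝ), 0 < ν → 0 < T →
      ∀ (u : ℝ → EuclideanSpace ℝ (Fin 3) → EuclideanSpace ℝ (Fin 3)) (p : ℝ → EuclideanSpace ℝ (Fin 3) → ℝ),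
        IsClassicalNSSolutionOn (Ico 0 T) ν 0 u p → IsLerayHopfOn T ν 0 (u 0) u →
        HasRapidSpatialDecay (u 0) →
        ∃ T₂ ∈ Ioo 0 T, (∫⁻ t in Ioo T₂ T, eLpNorm (u t) 3 volume ^ q) < ⊤)
    (hS : ∀ (ν T : ℝ), 0 < ν → 0 < T →
      ∀ (u : ℝ → EuclideanSpace ℝ (Fin 3) → EuclideanSpace ℝ (Fin 3)) (p : ℝ → EuclideanSpace ℝ (Fin 3) → ℝ),
        IsClassicalNSSolutionOn (Ico 0 T) ν 0 u p → IsLerayHopfOn T ν 0 (u 0) u →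
        HasRapidSpatialDecay (u 0) →
        (∃ T₂ ∈ Ioo 0 T, (∫⁻ t in Ioo T₂ T, eLpNorm (u t) 3 volume ^ q) < ⊤) →
        HasSmoothExtensionPast ν 0 u T) :
    _root_.NavierStokesRegularity :=
  noBlowupToClay_item fun ν T hν hT u p hcl hLH hdec =>
    hS ν T hν hT u p hcl hLH hdec (hJ ν T hν hT u p hcl hLH hdec)

/-! ## Both halves are on path, at every exponent -/

/-- **Smooth branch, every exponent**: a frame solution that extends smoothly past `T` has
`∫₀ᵀ ‖u(t)‖₃^q dt < ∞` for every `q ≥ 0` (`‖u(t)‖₃³ ≤ M` on `[0,T)`,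
`eLpNorm_three_bounded_of_hasSmoothExtensionPast`). [cite: Tao2011, Cor. 11.1 + Cor. 4.3 + Thm. 5.4 (iv)] -/
theorem lintegral_l3_rpow_lt_top_of_hasSmoothExtensionPast {ν T : ℝ} (hν : 0 < ν) (hT : 0 < T)
    {u : ℝ → EuclideanSpace ℝ (Fin 3) → EuclideanSpace ℝ (Fin 3)}
    (hLH : IsLerayHopfOn T ν 0 (u 0) u) (hdec : HasRapidSpatialDecay (u 0))
    (hext : HasSmoothExtensionPast ν 0 u T) {q : ℝ} (hq : 0 ≤ q) :
    (∫⁻ t in Ioo 0 T, eLpNorm (u t) 3 volume ^ q) < ⊤ := by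
  obtain ⟨M, hM0, hM⟩ := eLpNorm_three_bounded_of_hasSmoothExtensionPast hν hT hLH hdec hext
  have hpt : ∀ t ∈ Ioo 0 T, eLpNorm (u t) 3 volume ^ q ≤ ENNReal.ofReal M ^ (q / 3) := by
    intro t ht
    have h := ENNReal.rpow_le_rpow (hM t ⟨ht.1.le, ht.2⟩) (show 0 ≤ q / 3 by positivity)
    rw [← ENNReal.rpow_mul, show (3 : ℝ) * (q / 3) = q by ring] at h
    exact h
  refine lt_of_le_of_lt (setLIntegral_mono' measurableSet_Ioo fun t ht => hpt t ht) ?_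
  rw [setLIntegral_const, Real.volume_Ioo]
  exact ENNReal.mul_lt_top (ENNReal.rpow_lt_top_of_nonneg (by positivity) ENNReal.ofReal_ne_top)
    ENNReal.ofReal_lt_top

/-- **The jaw at every exponent `q ≥ 0` is ON PATH**: Clay (A) ⇒ no frame blow-up
(`HodographBetchov.noBlowup_of_navierStokesRegularity`) ⇒ every frame solution is on the smooth branch,
where `∫ ‖u‖₃^q < ∞`. [folklore] -/
theorem jawAt_of_navierStokesRegularity {q : ℝ} (hq : 0 ≤ q) (hA : _root_.NavierStokesRegularity) :
    ∀ (ν T : ℝ), 0 < ν → 0 < T →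
      ∀ (u : ℝ → EuclideanSpace ℝ (Fin 3) → EuclideanSpace ℝ (Fin 3)) (p : ℝ → EuclideanSpace ℝ (Fin 3) → ℝ),
        IsClassicalNSSolutionOn (Ico 0 T) ν 0 u p → IsLerayHopfOn T ν 0 (u 0) u →
        HasRapidSpatialDecay (u 0) →
        ∃ T₂ ∈ Ioo 0 T, (∫⁻ t in Ioo T₂ T, eLpNorm (u t) 3 volume ^ q) < ⊤ := by
  intro ν T hν hT u p hcl hLH hdec
  have hext := HodographBetchov.noBlowup_of_navierStokesRegularity hA ν T hν hT u p hcl hLH hdec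
  refine ⟨T / 2, ⟨by linarith, by linarith⟩, ?_⟩
  exact lt_of_le_of_lt (lintegral_mono_set (Ioo_subset_Ioo_left (by linarith)))
    (lintegral_l3_rpow_lt_top_of_hasSmoothExtensionPast hν hT hLH hdec hext hq)

/-- **Serrin at every exponent is ON PATH** (its conclusion is no-blow-up, which (A) gives outright).
[folklore] -/
theorem serrinAt_of_navierStokesRegularity (q : ℝ) (hA : _root_.NavierStokesRegularity) :
    ∀ (ν T : ℝ), 0 < ν → 0 < T →
      ∀ (u : ℝ → EuclideanSpace ℝ (Fin 3) → EuclideanSpace ℝ (Fin 3)) (p : ℝ → EuclideanSpace ℝ (Fin 3) → ℝ),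
        IsClassicalNSSolutionOn (Ico 0 T) ν 0 u p → IsLerayHopfOn T ν 0 (u 0) u →
        HasRapidSpatialDecay (u 0) →
        (∃ T₂ ∈ Ioo 0 T, (∫⁻ t in Ioo T₂ T, eLpNorm (u t) 3 volume ^ q) < ⊤) →
        HasSmoothExtensionPast ν 0 u T :=
  fun ν T hν hT u p hcl hLH hdec _ =>
    HodographBetchov.noBlowup_of_navierStokesRegularity hA ν T hν hT u p hcl hLH hdec

/-- **The exponent continuum: for every `q ≥ 0`, `NavierStokesRegularity ↔ (jaw at q) ∧ (Serrin at q)`.**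
[folklore] -/
theorem navierStokesRegularity_iff_pincerAt {q : ℝ} (hq : 0 ≤ q) :
    _root_.NavierStokesRegularity ↔
      (∀ (ν T : ℝ), 0 < ν → 0 < T →
        ∀ (u : ℝ → EuclideanSpace ℝ (Fin 3) → EuclideanSpace ℝ (Fin 3)) (p : ℝ → EuclideanSpace ℝ (Fin 3) → ℝ),
          IsClassicalNSSolutionOn (Ico 0 T) ν 0 u p → IsLerayHopfOn T ν 0 (u 0) u →
          HasRapidSpatialDecay (u 0) →
          ∃ T₂ ∈ Ioo 0 T, (∫⁻ t in Ioo T₂ T, eLpNorm (u t) 3 volume ^ q) < ⊤) ∧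
      (∀ (ν T : ℝ), 0 < ν → 0 < T →
        ∀ (u : ℝ → EuclideanSpace ℝ (Fin 3) → EuclideanSpace ℝ (Fin 3)) (p : ℝ → EuclideanSpace ℝ (Fin 3) → ℝ),
          IsClassicalNSSolutionOn (Ico 0 T) ν 0 u p → IsLerayHopfOn T ν 0 (u 0) u →
          HasRapidSpatialDecay (u 0) →
          (∃ T₂ ∈ Ioo 0 T, (∫⁻ t in Ioo T₂ T, eLpNorm (u t) 3 volume ^ q) < ⊤) →
          HasSmoothExtensionPast ν 0 u T) :=
  ⟨fun hA => ⟨jawAt_of_navierStokesRegularity hq hA, serrinAt_of_navierStokesRegularity q hA⟩,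
    fun h => navierStokesRegularity_of_pincerAt q h.1 h.2⟩

/-! ## Monotonicity along the continuum -/

/-- **The jaw is antitone in the exponent** (harder as `q` grows): jaw at `q` ⇒ jaw at every
`0 ≤ q' ≤ q`. [folklore] -/
theorem jawAt_anti {q q' : ℝ} (hq' : 0 ≤ q') (hle : q' ≤ q)
    (hJ : ∀ (ν T : ℝ), 0 < ν → 0 < T →
      ∀ (u : ℝ → EuclideanSpace ℝ (Fin 3) → EuclideanSpace ℝ (Fin 3)) (p : ℝ → EuclideanSpace ℝ (Fin 3) → ℝ),
        IsClassicalNSSolutionOn (Ico 0 T) ν 0 u p → IsLerayHopfOn T ν 0 (u 0) u →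
        HasRapidSpatialDecay (u 0) →
        ∃ T₂ ∈ Ioo 0 T, (∫⁻ t in Ioo T₂ T, eLpNorm (u t) 3 volume ^ q) < ⊤) :
    ∀ (ν T : ℝ), 0 < ν → 0 < T →
      ∀ (u : ℝ → EuclideanSpace ℝ (Fin 3) → EuclideanSpace ℝ (Fin 3)) (p : ℝ → EuclideanSpace ℝ (Fin 3) → ℝ),
        IsClassicalNSSolutionOn (Ico 0 T) ν 0 u p → IsLerayHopfOn T ν 0 (u 0) u →
        HasRapidSpatialDecay (u 0) →
        ∃ T₂ ∈ Ioo 0 T, (∫⁻ t in Ioo T₂ T, eLpNorm (u t) 3 volume ^ q') < ⊤ :=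
  fun ν T hν hT u p hcl hLH hdec => jawClause_anti hq' hle (hJ ν T hν hT u p hcl hLH hdec)

/-- **Serrin is monotone in the exponent** (easier as `q` grows: the window hypothesis at `q' ≥ q`
implies the one at `q`). [folklore] -/
theorem serrinAt_mono {q q' : ℝ} (hq : 0 ≤ q) (hle : q ≤ q')
    (hS : ∀ (ν T : ℝ), 0 < ν → 0 < T →
      ∀ (u : ℝ → EuclideanSpace ℝ (Fin 3) → EuclideanSpace ℝ (Fin 3)) (p : ℝ → EuclideanSpace ℝ (Fin 3) → ℝ),
        IsClassicalNSSolutionOn (Ico 0 T) ν 0 u p → IsLerayHopfOn T ν 0 (u 0) u →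
        HasRapidSpatialDecay (u 0) →
        (∃ T₂ ∈ Ioo 0 T, (∫⁻ t in Ioo T₂ T, eLpNorm (u t) 3 volume ^ q) < ⊤) →
        HasSmoothExtensionPast ν 0 u T) :
    ∀ (ν T : ℝ), 0 < ν → 0 < T →
      ∀ (u : ℝ → EuclideanSpace ℝ (Fin 3) → EuclideanSpace ℝ (Fin 3)) (p : ℝ → EuclideanSpace ℝ (Fin 3) → ℝ),
        IsClassicalNSSolutionOn (Ico 0 T) ν 0 u p → IsLerayHopfOn T ν 0 (u 0) u →
        HasRapidSpatialDecay (u 0) →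
        (∃ T₂ ∈ Ioo 0 T, (∫⁻ t in Ioo T₂ T, eLpNorm (u t) 3 volume ^ q') < ⊤) →
        HasSmoothExtensionPast ν 0 u T :=
  fun ν T hν hT u p hcl hLH hdec hwin => hS ν T hν hT u p hcl hLH hdec (jawClause_anti hq hle hwin)

/-! ## The route's items are points of the continuum -/

/-- `L3CascadeJaw` is the jaw at every `q ∈ (4,5)` (definitional). [folklore] -/
theorem jawAt_of_l3CascadeJaw (hJ : L3CascadeJaw) {q : ℝ} (hq4 : 4 < q) (hq5 : q < 5) :
    ∀ (ν T : ℝ), 0 < ν → 0 < T →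
      ∀ (u : ℝ → EuclideanSpace ℝ (Fin 3) → EuclideanSpace ℝ (Fin 3)) (p : ℝ → EuclideanSpace ℝ (Fin 3) → ℝ),
        IsClassicalNSSolutionOn (Ico 0 T) ν 0 u p → IsLerayHopfOn T ν 0 (u 0) u →
        HasRapidSpatialDecay (u 0) →
        ∃ T₂ ∈ Ioo 0 T, (∫⁻ t in Ioo T₂ T, eLpNorm (u t) 3 volume ^ q) < ⊤ :=
  hJ q hq4 hq5

/-- `SupercriticalSerrinL3` is Serrin at SOME `q ∈ (4,5)` (definitional). [folklore] -/
theorem serrinAt_of_supercriticalSerrinL3 (hS : SupercriticalSerrinL3) :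
    ∃ q : ℝ, 4 < q ∧ q < 5 ∧ ∀ (ν T : ℝ), 0 < ν → 0 < T →
      ∀ (u : ℝ → EuclideanSpace ℝ (Fin 3) → EuclideanSpace ℝ (Fin 3)) (p : ℝ → EuclideanSpace ℝ (Fin 3) → ℝ),
        IsClassicalNSSolutionOn (Ico 0 T) ν 0 u p → IsLerayHopfOn T ν 0 (u 0) u →
        HasRapidSpatialDecay (u 0) →
        (∃ T₂ ∈ Ioo 0 T, (∫⁻ t in Ioo T₂ T, eLpNorm (u t) 3 volume ^ q) < ⊤) →
        HasSmoothExtensionPast ν 0 u T :=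
  hS

/-! ## The left end `q ≤ 4`: the jaw is a theorem, the pincer is the Serrin criterion -/

/-- For `0 ≤ q ≤ 4` the jaw holds unconditionally (energy floor `l3Jaw_four`, p425265; re-exported). [cite: RobinsonRodrigoSadowski2016, Lemma 3.5] -/
theorem jawAt_of_le_four' {q : ℝ} (hq0 : 0 ≤ q) (hq4 : q ≤ 4) :
    ∀ (ν T : ℝ), 0 < ν → 0 < T →
      ∀ (u : ℝ → EuclideanSpace ℝ (Fin 3) → EuclideanSpace ℝ (Fin 3)) (p : ℝ → EuclideanSpace ℝ (Fin 3) → ℝ),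
        IsClassicalNSSolutionOn (Ico 0 T) ν 0 u p → IsLerayHopfOn T ν 0 (u 0) u →
        HasRapidSpatialDecay (u 0) →
        ∃ T₂ ∈ Ioo 0 T, (∫⁻ t in Ioo T₂ T, eLpNorm (u t) 3 volume ^ q) < ⊤ :=
  jawClause_of_le_four q hq0 hq4

/-- **Left end of the continuum**: for `0 ≤ q ≤ 4`, `NavierStokesRegularity ↔ (Serrin at q)` — below the
energy exponent the jaw half is free and the whole of Clay (A) sits in the Serrin criterion at `q`
(at `q = 4`: "every frame solution in `L⁴_t L³_x` near `T` extends", i.e. no blow-up, since every frame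
solution IS in `L⁴_t L³_x`). [folklore] -/
theorem navierStokesRegularity_iff_serrinAt_of_le_four {q : ℝ} (hq0 : 0 ≤ q) (hq4 : q ≤ 4) :
    _root_.NavierStokesRegularity ↔
      ∀ (ν T : ℝ), 0 < ν → 0 < T →
        ∀ (u : ℝ → EuclideanSpace ℝ (Fin 3) → EuclideanSpace ℝ (Fin 3)) (p : ℝ → EuclideanSpace ℝ (Fin 3) → ℝ),
          IsClassicalNSSolutionOn (Ico 0 T) ν 0 u p → IsLerayHopfOn T ν 0 (u 0) u →
          HasRapidSpatialDecay (u 0) →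
          (∃ T₂ ∈ Ioo 0 T, (∫⁻ t in Ioo T₂ T, eLpNorm (u t) 3 volume ^ q) < ⊤) →
          HasSmoothExtensionPast ν 0 u T :=
  ⟨serrinAt_of_navierStokesRegularity q,
    fun hS => navierStokesRegularity_of_pincerAt q (jawAt_of_le_four' hq0 hq4) hS⟩

/-! ## The right end `q = ∞`: Serrin is a theorem (ESS), the pincer is the `L^∞_t L³_x` jaw -/

/-- **Smooth branch at the right end**: a frame solution that extends smoothly past `T` lies in
`L^∞(T/2, T; L³)` (`MemLqLp ∞ 3`): every slice is in `L³` (`eLpNorm_three_lt_top_of_frame`) and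
`‖u(t)‖₃ ≤ M^{1/3}` on `[0,T)`. [cite: Tao2011, Cor. 11.1 + Cor. 4.3 + Thm. 5.4 (iv)] -/
theorem memLqLp_top_three_of_hasSmoothExtensionPast {ν T : ℝ} (hν : 0 < ν) (hT : 0 < T)
    {u : ℝ → EuclideanSpace ℝ (Fin 3) → EuclideanSpace ℝ (Fin 3)} {p : ℝ → EuclideanSpace ℝ (Fin 3) → ℝ}
    (hcl : IsClassicalNSSolutionOn (Ico 0 T) ν 0 u p) (hLH : IsLerayHopfOn T ν 0 (u 0) u)
    (hdec : HasRapidSpatialDecay (u 0)) (hext : HasSmoothExtensionPast ν 0 u T) :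
    MemLqLp ∞ 3 u (Ioo (T / 2) T) := by
  obtain ⟨M, hM0, hM⟩ := eLpNorm_three_bounded_of_hasSmoothExtensionPast hν hT hLH hdec hext
  have hsub : Ioo (T / 2) T ⊆ Ico 0 T := fun t ht => ⟨by linarith [ht.1], ht.2⟩
  refine ⟨?_, ?_⟩
  · -- every slice of the window is in `L³`
    refine (ae_restrict_mem measurableSet_Ioo).mono fun t ht => ?_
    exact ⟨((hcl.contDiff_velocity (hsub ht)).continuous).aestronglyMeasurable,
      eLpNorm_three_lt_top_of_frame hν hcl hLH hdec (hsub ht)⟩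
  · -- the mixed norm is an essential supremum of `‖u(t)‖₃ ≤ M^{1/3}`
    have hbd : ∀ t ∈ Ioo (T / 2) T, ‖(eLpNorm (u t) 3 volume).toReal‖ ≤ M ^ (1 / 3 : ℝ) := by
      intro t ht
      rw [Real.norm_of_nonneg ENNReal.toReal_nonneg]
      have h3 : eLpNorm (u t) 3 volume ≤ ENNReal.ofReal (M ^ (1 / 3 : ℝ)) := by
        have h := ENNReal.rpow_le_rpow (hM t (hsub ht)) (show (0 : ℝ) ≤ 1 / 3 by norm_num)
        rw [← ENNReal.rpow_mul, show (3 : ℝ) * (1 / 3) = 1 by norm_num, ENNReal.rpow_one,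
          ENNReal.ofReal_rpow_of_nonneg hM0 (by norm_num)] at h
        exact h
      exact ENNReal.toReal_le_of_le_ofReal (Real.rpow_nonneg hM0 _) h3
    have hae : ∀ᵐ t ∂(volume.restrict (Ioo (T / 2) T)),
        ‖(eLpNorm (u t) 3 volume).toReal‖ ≤ M ^ (1 / 3 : ℝ) :=
      (ae_restrict_mem measurableSet_Ioo).mono fun t ht => hbd t ht
    show eLqLpNorm ∞ 3 u (Ioo (T / 2) T) < ∞
    rw [eLqLpNorm_def, eLpNorm_exponent_top]
    exact eLpNormEssSup_lt_top_of_ae_bound hae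

/-- **Right end of the continuum**: `NavierStokesRegularity ↔` "every frame solution lies in
`L^∞(T₂,T; L³)` on some final window".  (⇐) is Escauriaza–Seregin–Šverák in the frame
(`supercriticalSerrinL3_rung_top`, p429062) plus `NoBlowupToClay`; (⇒) is the smooth branch. At
`q = ∞` the Serrin half is free and the whole of Clay (A) sits in the jaw. [cite: EscauriazaSereginSverak2003, Thms. 1.3–1.4] -/
theorem navierStokesRegularity_iff_jawTop :
    _root_.NavierStokesRegularity ↔
      ∀ (ν T : ℝ), 0 < ν → 0 < T →
        ∀ (u : ℝ → EuclideanSpace ℝ (Fin 3) → EuclideanSpace ℝ (Fin 3)) (p : ℝ → EuclideanSpace ℝ (Fin 3) → ℝ),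
          IsClassicalNSSolutionOn (Ico 0 T) ν 0 u p → IsLerayHopfOn T ν 0 (u 0) u →
          HasRapidSpatialDecay (u 0) → ∃ T₂ ∈ Ioo 0 T, MemLqLp ∞ 3 u (Ioo T₂ T) := by
  constructor
  · intro hA ν T hν hT u p hcl hLH hdec
    exact ⟨T / 2, ⟨by linarith, by linarith⟩, memLqLp_top_three_of_hasSmoothExtensionPast hν hT hcl hLH hdec
      (HodographBetchov.noBlowup_of_navierStokesRegularity hA ν T hν hT u p hcl hLH hdec)⟩
  · intro hJ
    exact noBlowupToClay_item fun ν T hν hT u p hcl hLH hdec =>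
      supercriticalSerrinL3_rung_top ν T hν hT u p hcl hLH hdec (hJ ν T hν hT u p hcl hLH hdec)

/-- **The `L^∞` jaw dominates every finite jaw**: an `L^∞(T₂,T; L³)` window is an `L^q(T₂,T; L³)`
window for every `q ≥ 0` (`lintegral_rpow_lt_top_of_memLqLp_top`), so the right-end jaw implies the jaw
at every finite exponent — the top of the antitone family `jawAt_anti`. [folklore] -/
theorem jawAt_of_jawTop {q : ℝ} (hq : 0 ≤ q)
    (hJ : ∀ (ν T : ℝ), 0 < ν → 0 < T →
      ∀ (u : ℝ → EuclideanSpace ℝ (Fin 3) → EuclideanSpace ℝ (Fin 3)) (p : ℝ → EuclideanSpace ℝ (Fin 3) → ℝ),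
        IsClassicalNSSolutionOn (Ico 0 T) ν 0 u p → IsLerayHopfOn T ν 0 (u 0) u →
        HasRapidSpatialDecay (u 0) → ∃ T₂ ∈ Ioo 0 T, MemLqLp ∞ 3 u (Ioo T₂ T)) :
    ∀ (ν T : ℝ), 0 < ν → 0 < T →
      ∀ (u : ℝ → EuclideanSpace ℝ (Fin 3) → EuclideanSpace ℝ (Fin 3)) (p : ℝ → EuclideanSpace ℝ (Fin 3) → ℝ),
        IsClassicalNSSolutionOn (Ico 0 T) ν 0 u p → IsLerayHopfOn T ν 0 (u 0) u →
        HasRapidSpatialDecay (u 0) →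
        ∃ T₂ ∈ Ioo 0 T, (∫⁻ t in Ioo T₂ T, eLpNorm (u t) 3 volume ^ q) < ⊤ := by
  intro ν T hν hT u p hcl hLH hdec
  obtain ⟨T₂, hT₂, hmem⟩ := hJ ν T hν hT u p hcl hLH hdec
  exact ⟨T₂, hT₂, lintegral_rpow_lt_top_of_memLqLp_top hmem hq⟩

end Summit.NavierStokesRegularity.NavierStokesRegularity.Theorems.L3TimeExponentPincerExponentContinuum

end
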